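import Mathlib
import Summits.ValiantsHypothesis.ValiantsHypothesis.Theorems.BarrierLeverPartitionMinorsHitByVPHiddenStatesPairBlockMatrix

/-!
# Route BarrierLever — item `PartitionMinorsHitByVP` (stmt-ValiantsHypothesis-19717), line `hidden_states`:
# THE SHARED-QUADRIC LAW — the first CROSS-PIECE law: two pair blocks over-filling a sub-cube are jointly singular on its pair rows

Helper file (`--supports stmt-ValiantsHypothesis-19717`; cell valiant-natproofs, rung V4, 𝒟-side door (c), line `hidden_states`, node #1;
prover seat val-np-p3 gen 21; memo HOME/val-np-p3/g21/MEMO-bpwindow-valnp3-g21.md §11). Definition-light. Closes NO item.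

THE LAW (single table `g : Fin K → Fin h → ℂ`, zero base point, configuration matrix `PairBlock.cfgMat`: entry `(i,k) = ∏_{a ∈ U i} Σ_{q ∈ cols k} g q a`).
Let every row be a 2-subset of `T ⊆ Fin h` and let `S_A, S_B ⊆ Fin K` be state sets with `|T| < |S_A| + |S_B|`. Then

  `#{(q,q') ∈ S_A², q ≤ q'} + #{(q,q') ∈ S_B², q ≤ q'} + #{k : cols k ⊄ S_A ∧ cols k ⊄ S_B} ≤ n  ⟹  det (cfgMat U cols g) = 0`  (`det_cfgMat_eq_zero_sharedQuadric`)

FOR EVERY TABLE. Mechanism (memo §11): on a pair row `{a,b}` a column with point `z` reads `z(a)z(b)`, so the columns inside `S_A` are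
combinations of the generators `w_{q,q'} = g_q(a)g_{q'}(b) + g_{q'}(a)g_q(b)` (`q ≤ q'` in `S_A`), likewise for `S_B`; since `|S_A| + |S_B| > |T|`
some nonzero `κ` has `Σ_{S_A} κ_q g_q = Σ_{S_B} κ_q g_q` on `T` (`exists_shared_vector`, plain dimension count), and then
`Σ_{q≤q' ∈ S_A} m κ_qκ_{q'} w_{q,q'} = Σ_{q ≤ q' ∈ S_B} m κ_qκ_{q'} w_{q,q'}` (`m = 1` on the diagonal, `2` off it) is a nontrivial relation among
the generators; rank–nullity bounds the column span by `#generators − 1 < n`.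
CONSEQUENCE (memo §11, kit j332332): for two complete pair blocks `PB(b_A)`, `PB(b_B)` with `b_A + b_B > t` on the pair rows `E(K_t)` the joint
rank is `≤ C(b_A+1,2) + C(b_B+1,2) − 1` although each block alone has full rank and the rows DO split into per-piece bases (e.g. `PB4 + PB4 + one
free state` on `E(K₇)`: base-partitions exist, `det = 0` identically): «union ⇒ good» is FALSE for hidden-state joins — the Laplace expansion over
base-partitions (`JoinLaplace.det_eq_sum_blockZeroL`, p724436) can cancel identically. The law does not touch the design of record (all its pieces
have `b ≥ h ≥ t` states and saturate every sub-cube). WHAT THIS IS NOT: nothing on crux 14610 or VP ≠ VNP; item 19717 stays OPEN.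
-/

set_option linter.dupNamespace false

namespace Summit.ValiantsHypothesis.ValiantsHypothesis.Theorems.BarrierLever.HiddenStates

open Finset Matrix

noncomputable section

namespace SharedQuadric

open PairBlock

variable {h K n : ℕ}

/-! ## 1. The symmetrised pair generators -/

/-- The symmetrised generator of the ordered pair `(q, q')` on the row `U`: `Σ_{x ∈ U} Σ_{y ∈ U ∖ x} g q x · g q' y`
(for `U = {a, b}` this is `g q a · g q' b + g q' a · g q b`; no orientation of the row is needed). -/
def gen (g : Fin K → Fin h → ℂ) (U : Finset (Fin h)) (p : Fin K × Fin K) : ℂ :=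
  ∑ x ∈ U, ∑ y ∈ U.erase x, g p.1 x * g p.2 y

/-- The generator is symmetric in the pair. -/
theorem gen_swap (g : Fin K → Fin h → ℂ) (U : Finset (Fin h)) (p : Fin K × Fin K) : gen g U p.swap = gen g U p := by
  classical
  simp only [gen, Prod.fst_swap, Prod.snd_swap]
  rw [Finset.sum_sigma' U fun x => U.erase x, Finset.sum_sigma' U fun x => U.erase x]
  refine Finset.sum_bij' (fun s _ => ⟨s.2, s.1⟩) (fun s _ => ⟨s.2, s.1⟩) ?_ ?_ ?_ ?_ ?_
  · intro s hs
    rw [Finset.mem_sigma] at hs ⊢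
    exact ⟨Finset.mem_of_mem_erase hs.2, Finset.mem_erase.mpr ⟨(Finset.ne_of_mem_erase hs.2).symm, hs.1⟩⟩
  · intro s hs
    rw [Finset.mem_sigma] at hs ⊢
    exact ⟨Finset.mem_of_mem_erase hs.2, Finset.mem_erase.mpr ⟨(Finset.ne_of_mem_erase hs.2).symm, hs.1⟩⟩
  · intro s _; rfl
  · intro s _; rfl
  · intro s _; ring

/-- On a two-element row the product of a subset sum splits into ordered-pair generators:
`∏_{x ∈ U} Σ_{q ∈ J} g q x = ½ Σ_{(q,q') ∈ J × J} gen g U (q,q')`. -/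
theorem prod_sum_eq_half_sum_gen (g : Fin K → Fin h → ℂ) {U : Finset (Fin h)} (hU : U.card = 2) (J : Finset (Fin K)) :
    ∏ x ∈ U, ∑ q ∈ J, g q x = (1 / 2 : ℂ) * ∑ p ∈ J ×ˢ J, gen g U p := by
  classical
  obtain ⟨a, b, hab, rfl⟩ := Finset.card_eq_two.mp hU
  have hgen : ∀ p : Fin K × Fin K, gen g {a, b} p = g p.1 a * g p.2 b + g p.1 b * g p.2 a := by
    intro p
    simp only [gen]
    rw [Finset.sum_pair hab, Finset.erase_insert (by simpa using hab), Finset.sum_singleton,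
      Finset.pair_comm, Finset.erase_insert (by simpa using hab.symm), Finset.sum_singleton]
  rw [Finset.prod_pair hab, Finset.sum_mul_sum, ← Finset.sum_product']
  simp only [hgen, Finset.sum_add_distrib]
  have hsym : ∑ p ∈ J ×ˢ J, g p.1 b * g p.2 a = ∑ p ∈ J ×ˢ J, g p.1 a * g p.2 b := by
    rw [← Finset.sum_equiv (Equiv.prodComm (Fin K) (Fin K)) (s := J ×ˢ J) (t := J ×ˢ J)
      (f := fun p => g p.1 b * g p.2 a) (g := fun p => g p.1 a * g p.2 b)]
    · intro p; simp [Finset.mem_product, and_comm]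
    · intro p _; simp [mul_comm]
  rw [hsym]; ring

/-- The same splitting for the shared quadric: `Σ_{(q,q') ∈ S × S} κ q κ q' · gen = Σ_x Σ_{y≠x} v x v y` with `v = Σ_{q ∈ S} κ q g q`. -/
theorem sum_kappa_gen (g : Fin K → Fin h → ℂ) (U : Finset (Fin h)) (S : Finset (Fin K)) (κ : Fin K → ℂ) :
    ∑ p ∈ S ×ˢ S, κ p.1 * κ p.2 * gen g U p =
      ∑ x ∈ U, ∑ y ∈ U.erase x, (∑ q ∈ S, κ q * g q x) * (∑ q ∈ S, κ q * g q y) := by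
  calc ∑ p ∈ S ×ˢ S, κ p.1 * κ p.2 * gen g U p
      = ∑ p ∈ S ×ˢ S, ∑ x ∈ U, ∑ y ∈ U.erase x, κ p.1 * κ p.2 * (g p.1 x * g p.2 y) := by
        refine Finset.sum_congr rfl fun p _ => ?_
        simp only [gen, Finset.mul_sum]
    _ = ∑ x ∈ U, ∑ p ∈ S ×ˢ S, ∑ y ∈ U.erase x, κ p.1 * κ p.2 * (g p.1 x * g p.2 y) := Finset.sum_comm
    _ = ∑ x ∈ U, ∑ y ∈ U.erase x, ∑ p ∈ S ×ˢ S, κ p.1 * κ p.2 * (g p.1 x * g p.2 y) :=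
        Finset.sum_congr rfl fun x _ => Finset.sum_comm
    _ = ∑ x ∈ U, ∑ y ∈ U.erase x, (∑ q ∈ S, κ q * g q x) * (∑ q ∈ S, κ q * g q y) := by
        refine Finset.sum_congr rfl fun x _ => Finset.sum_congr rfl fun y _ => ?_
        rw [Finset.sum_mul_sum, ← Finset.sum_product']
        exact Finset.sum_congr rfl fun p _ => by ring

/-! ## 2. A shared vector exists by dimension count -/

/-- If `|T| < |S_A| + |S_B|` then some nonzero coefficient vector `κ` (supported where it matters) has
`Σ_{q ∈ S_A} κ q g q x = Σ_{q ∈ S_B} κ q g q x` for every `x ∈ T`. -/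
theorem exists_shared_vector (g : Fin K → Fin h → ℂ) (T : Finset (Fin h)) (SA SB : Finset (Fin K)) (hdisj : Disjoint SA SB)
    (hdim : T.card < SA.card + SB.card) :
    ∃ κ : Fin K → ℂ, (∃ q ∈ SA ∪ SB, κ q ≠ 0) ∧
      ∀ x ∈ T, ∑ q ∈ SA, κ q * g q x = ∑ q ∈ SB, κ q * g q x := by
  classical
  -- the signed evaluation matrix `T × (SA ∪ SB)` and its linear map
  let M : Matrix ↥T ↥(SA ∪ SB) ℂ := Matrix.of fun x q => (if (q : Fin K) ∈ SA then (1 : ℂ) else -1) * g q x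
  let L : (↥(SA ∪ SB) → ℂ) →ₗ[ℂ] (↥T → ℂ) := M.mulVecLin
  have hlt : Module.finrank ℂ (↥T → ℂ) < Module.finrank ℂ (↥(SA ∪ SB) → ℂ) := by
    rw [Module.finrank_fintype_fun_eq_card, Module.finrank_fintype_fun_eq_card, Fintype.card_coe, Fintype.card_coe,
      Finset.card_union_of_disjoint hdisj]
    exact hdim
  have hker := LinearMap.ker_ne_bot_of_finrank_lt (f := L) hlt
  obtain ⟨c, hc, hc0⟩ := Submodule.exists_mem_ne_zero_of_ne_bot hker
  rw [LinearMap.mem_ker] at hc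
  set κ : Fin K → ℂ := fun q => if hq : q ∈ SA ∪ SB then c ⟨q, hq⟩ else 0 with hκ
  have hκc : ∀ q : ↥(SA ∪ SB), κ q = c q := fun q => by
    have hq : (q : Fin K) ∈ SA ∪ SB := q.2
    simp only [hκ, dif_pos hq]
  refine ⟨κ, ?_, ?_⟩
  · by_contra hall
    push Not at hall
    apply hc0
    funext q
    rw [← hκc q]
    exact hall q q.2
  · intro x hx
    have hcx : (M.mulVec c) ⟨x, hx⟩ = 0 := by
      have := congrFun hc ⟨x, hx⟩
      simpa [L] using this
    simp only [Matrix.mulVec, dotProduct, M, Matrix.of_apply] at hcx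
    -- as a sum over the finset `SA ∪ SB`
    have hsum : ∑ q ∈ SA ∪ SB, (if q ∈ SA then (1 : ℂ) else -1) * g q x * κ q = 0 := by
      rw [← hcx, ← Finset.sum_coe_sort (SA ∪ SB)]
      exact Finset.sum_congr rfl fun q _ => by rw [hκc q]
    rw [Finset.sum_union hdisj] at hsum
    have hA : ∑ q ∈ SA, (if q ∈ SA then (1 : ℂ) else -1) * g q x * κ q = ∑ q ∈ SA, κ q * g q x :=
      Finset.sum_congr rfl fun q hq => by rw [if_pos hq]; ring
    have hB : ∑ q ∈ SB, (if q ∈ SA then (1 : ℂ) else -1) * g q x * κ q = -∑ q ∈ SB, κ q * g q x := by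
      rw [← Finset.sum_neg_distrib]
      refine Finset.sum_congr rfl fun q hq => ?_
      rw [if_neg (Finset.disjoint_right.mp hdisj hq)]; ring
    rw [hA, hB] at hsum
    linear_combination hsum

/-! ## 3. The law -/

/-- **THE SHARED-QUADRIC LAW.** See the module docstring. -/
theorem det_cfgMat_eq_zero_sharedQuadric (U : Fin n → Finset (Fin h)) (cols : Fin n → Finset (Fin K))
    (g : Fin K → Fin h → ℂ) (T : Finset (Fin h)) (hU : ∀ i, U i ⊆ T ∧ (U i).card = 2)
    (SA SB : Finset (Fin K)) (hdisj : Disjoint SA SB) (hdim : T.card < SA.card + SB.card)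
    (hcount : ((SA ×ˢ SA).filter fun p => p.1 ≤ p.2).card + ((SB ×ˢ SB).filter fun p => p.1 ≤ p.2).card +
      (Finset.univ.filter fun k => ¬ cols k ⊆ SA ∧ ¬ cols k ⊆ SB).card ≤ n) :
    (cfgMat U cols g).det = 0 := by
  classical
  -- generators
  set GA := (SA ×ˢ SA).filter fun p => p.1 ≤ p.2 with hGA
  set GB := (SB ×ˢ SB).filter fun p => p.1 ≤ p.2 with hGB
  set Oth := Finset.univ.filter fun k : Fin n => ¬ cols k ⊆ SA ∧ ¬ cols k ⊆ SB with hOth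
  let Gen := ↥GA ⊕ (↥GB ⊕ ↥Oth)
  let vec : Gen → (Fin n → ℂ)
    | Sum.inl p => fun i => gen g (U i) p.1
    | Sum.inr (Sum.inl p) => fun i => gen g (U i) p.1
    | Sum.inr (Sum.inr k) => fun i => cfgMat U cols g i k.1
  set W : Submodule ℂ (Fin n → ℂ) := Submodule.span ℂ (Set.range vec) with hW
  -- (a) every generator of an ordered pair of `SA` (resp. `SB`) is in `W`
  have hgenA : ∀ p ∈ SA ×ˢ SA, (fun i => gen g (U i) p) ∈ W := by
    intro p hp
    rw [Finset.mem_product] at hp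
    by_cases hle : p.1 ≤ p.2
    · exact Submodule.subset_span ⟨Sum.inl ⟨p, by rw [hGA, Finset.mem_filter, Finset.mem_product]; exact ⟨hp, hle⟩⟩, rfl⟩
    · have hmem : p.swap ∈ GA := by
        rw [hGA, Finset.mem_filter, Finset.mem_product]
        exact ⟨⟨hp.2, hp.1⟩, le_of_lt (lt_of_not_ge hle)⟩
      have : (fun i => gen g (U i) p) = fun i => gen g (U i) p.swap := funext fun i => (gen_swap g (U i) p).symm
      rw [this]
      exact Submodule.subset_span ⟨Sum.inl ⟨p.swap, hmem⟩, rfl⟩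
  have hgenB : ∀ p ∈ SB ×ˢ SB, (fun i => gen g (U i) p) ∈ W := by
    intro p hp
    rw [Finset.mem_product] at hp
    by_cases hle : p.1 ≤ p.2
    · exact Submodule.subset_span ⟨Sum.inr (Sum.inl ⟨p, by rw [hGB, Finset.mem_filter, Finset.mem_product]; exact ⟨hp, hle⟩⟩), rfl⟩
    · have hmem : p.swap ∈ GB := by
        rw [hGB, Finset.mem_filter, Finset.mem_product]
        exact ⟨⟨hp.2, hp.1⟩, le_of_lt (lt_of_not_ge hle)⟩
      have : (fun i => gen g (U i) p) = fun i => gen g (U i) p.swap := funext fun i => (gen_swap g (U i) p).symm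
      rw [this]
      exact Submodule.subset_span ⟨Sum.inr (Sum.inl ⟨p.swap, hmem⟩), rfl⟩
  -- (b) every column is in `W`
  have hcol : ∀ k, (fun i => cfgMat U cols g i k) ∈ W := by
    intro k
    by_cases hA : cols k ⊆ SA
    · have : (fun i => cfgMat U cols g i k) = (1 / 2 : ℂ) • ∑ p ∈ cols k ×ˢ cols k, fun i => gen g (U i) p := by
        funext i
        simp only [cfgMat, Matrix.of_apply, Pi.smul_apply, Finset.sum_apply, smul_eq_mul]
        exact prod_sum_eq_half_sum_gen g (hU i).2 (cols k)
      rw [this]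
      exact Submodule.smul_mem _ _ (Submodule.sum_mem _ fun p hp =>
        hgenA p (Finset.product_subset_product hA hA hp))
    by_cases hB : cols k ⊆ SB
    · have : (fun i => cfgMat U cols g i k) = (1 / 2 : ℂ) • ∑ p ∈ cols k ×ˢ cols k, fun i => gen g (U i) p := by
        funext i
        simp only [cfgMat, Matrix.of_apply, Pi.smul_apply, Finset.sum_apply, smul_eq_mul]
        exact prod_sum_eq_half_sum_gen g (hU i).2 (cols k)
      rw [this]
      exact Submodule.smul_mem _ _ (Submodule.sum_mem _ fun p hp =>
        hgenB p (Finset.product_subset_product hB hB hp))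
    · exact Submodule.subset_span ⟨Sum.inr (Sum.inr ⟨k, by rw [hOth, Finset.mem_filter]; exact ⟨Finset.mem_univ _, hA, hB⟩⟩), rfl⟩
  -- (c) a nontrivial relation among the generators: `dim W ≤ #Gen − 1`
  obtain ⟨κ, ⟨q₀, hq₀, hκ0⟩, hshared⟩ := exists_shared_vector g T SA SB hdisj hdim
  let Φ : (Gen → ℂ) →ₗ[ℂ] (Fin n → ℂ) := Fintype.linearCombination ℂ vec
  have hrange : LinearMap.range Φ = W := by
    rw [hW, Fintype.range_linearCombination]
  let ρ : Gen → ℂ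
    | Sum.inl p => (if p.1.1 = p.1.2 then 1 else 2) * (κ p.1.1 * κ p.1.2)
    | Sum.inr (Sum.inl p) => -((if p.1.1 = p.1.2 then 1 else 2) * (κ p.1.1 * κ p.1.2))
    | Sum.inr (Sum.inr _) => 0
  -- the weighted upper-triangular sum equals the full ordered sum
  have htri : ∀ (S : Finset (Fin K)) (F : Fin K × Fin K → ℂ), (∀ p, F p.swap = F p) →
      ∑ p ∈ (S ×ˢ S).filter (fun p => p.1 ≤ p.2), (if p.1 = p.2 then 1 else 2) * F p = ∑ p ∈ S ×ˢ S, F p := by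
    intro S F hF
    have hsplit : S ×ˢ S = (S ×ˢ S).filter (fun p => p.1 ≤ p.2) ∪ (S ×ˢ S).filter (fun p => p.2 < p.1) := by
      ext p
      simp only [Finset.mem_union, Finset.mem_filter]
      constructor
      · intro hp; rcases le_or_gt p.1 p.2 with h1 | h1; exacts [Or.inl ⟨hp, h1⟩, Or.inr ⟨hp, h1⟩]
      · rintro (⟨hp, -⟩ | ⟨hp, -⟩) <;> exact hp
    have hdj : Disjoint ((S ×ˢ S).filter (fun p => p.1 ≤ p.2)) ((S ×ˢ S).filter (fun p => p.2 < p.1)) := by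
      rw [Finset.disjoint_filter]; intro p _ h1 h2; exact absurd h2 (not_lt.mpr h1)
    have hR : ∑ p ∈ S ×ˢ S, F p =
        ∑ p ∈ (S ×ˢ S).filter (fun p => p.1 ≤ p.2), F p + ∑ p ∈ (S ×ˢ S).filter (fun p => p.2 < p.1), F p := by
      conv_lhs => rw [hsplit]
      exact Finset.sum_union hdj
    -- the strict lower part equals the strict upper part by swapping
    have hlow : ∑ p ∈ (S ×ˢ S).filter (fun p => p.2 < p.1), F p =
        ∑ p ∈ (S ×ˢ S).filter (fun p => p.1 < p.2), F p := by
      refine Finset.sum_bij' (fun p _ => p.swap) (fun p _ => p.swap) ?_ ?_ ?_ ?_ ?_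
      · intro p hp
        simp only [Finset.mem_filter, Finset.mem_product] at hp ⊢
        exact ⟨⟨hp.1.2, hp.1.1⟩, hp.2⟩
      · intro p hp
        simp only [Finset.mem_filter, Finset.mem_product] at hp ⊢
        exact ⟨⟨hp.1.2, hp.1.1⟩, hp.2⟩
      · intro p _; rfl
      · intro p _; rfl
      · intro p _; exact (hF p).symm
    -- split the `≤` part into `=` and `<`
    have hle : (S ×ˢ S).filter (fun p => p.1 ≤ p.2) =
        (S ×ˢ S).filter (fun p => p.1 = p.2) ∪ (S ×ˢ S).filter (fun p => p.1 < p.2) := by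
      ext p
      simp only [Finset.mem_union, Finset.mem_filter]
      constructor
      · intro hp; rcases lt_or_eq_of_le hp.2 with h1 | h1; exacts [Or.inr ⟨hp.1, h1⟩, Or.inl ⟨hp.1, h1⟩]
      · rintro (⟨hp, h1⟩ | ⟨hp, h1⟩); exacts [⟨hp, le_of_eq h1⟩, ⟨hp, le_of_lt h1⟩]
    have hdj2 : Disjoint ((S ×ˢ S).filter (fun p => p.1 = p.2)) ((S ×ˢ S).filter (fun p => p.1 < p.2)) := by
      rw [Finset.disjoint_filter]; intro p _ h1 h2; exact absurd h1 (ne_of_lt h2)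
    have hL : ∀ G : Fin K × Fin K → ℂ, ∑ p ∈ (S ×ˢ S).filter (fun p => p.1 ≤ p.2), G p =
        ∑ p ∈ (S ×ˢ S).filter (fun p => p.1 = p.2), G p + ∑ p ∈ (S ×ˢ S).filter (fun p => p.1 < p.2), G p := by
      intro G
      rw [hle]
      exact Finset.sum_union hdj2
    have h1 : ∑ p ∈ (S ×ˢ S).filter (fun p => p.1 = p.2), (if p.1 = p.2 then (1 : ℂ) else 2) * F p =
        ∑ p ∈ (S ×ˢ S).filter (fun p => p.1 = p.2), F p :=
      Finset.sum_congr rfl fun p hp => by rw [Finset.mem_filter] at hp; rw [if_pos hp.2, one_mul]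
    have h2 : ∑ p ∈ (S ×ˢ S).filter (fun p => p.1 < p.2), (if p.1 = p.2 then (1 : ℂ) else 2) * F p =
        ∑ p ∈ (S ×ˢ S).filter (fun p => p.1 < p.2), F p + ∑ p ∈ (S ×ˢ S).filter (fun p => p.1 < p.2), F p := by
      rw [← Finset.sum_add_distrib]
      refine Finset.sum_congr rfl fun p hp => ?_
      rw [Finset.mem_filter] at hp; rw [if_neg (ne_of_lt hp.2)]; ring
    rw [hL, h1, h2, hR, hlow, hL F]
    ring
  have hΦρ : Φ ρ = 0 := by
    funext i
    simp only [Φ, Fintype.linearCombination_apply, Finset.sum_apply, Pi.smul_apply, smul_eq_mul, Pi.zero_apply]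
    rw [Fintype.sum_sum_type, Fintype.sum_sum_type]
    simp only [ρ, vec, zero_mul, Finset.sum_const_zero, add_zero]
    -- the two quadric sums
    have hAsum : ∑ p : ↥GA, (if p.1.1 = p.1.2 then (1 : ℂ) else 2) * (κ p.1.1 * κ p.1.2) * gen g (U i) p.1 =
        ∑ x ∈ U i, ∑ y ∈ (U i).erase x, (∑ q ∈ SA, κ q * g q x) * (∑ q ∈ SA, κ q * g q y) := by
      rw [← sum_kappa_gen, ← htri SA (fun p => κ p.1 * κ p.2 * gen g (U i) p)
        (fun p => by rw [gen_swap]; simp [mul_comm])]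
      rw [← Finset.sum_coe_sort GA]
      refine Finset.sum_congr rfl fun p _ => by ring
    have hBsum : ∑ p : ↥GB, -((if p.1.1 = p.1.2 then (1 : ℂ) else 2) * (κ p.1.1 * κ p.1.2)) * gen g (U i) p.1 =
        -∑ x ∈ U i, ∑ y ∈ (U i).erase x, (∑ q ∈ SB, κ q * g q x) * (∑ q ∈ SB, κ q * g q y) := by
      rw [← sum_kappa_gen, ← htri SB (fun p => κ p.1 * κ p.2 * gen g (U i) p)
        (fun p => by rw [gen_swap]; simp [mul_comm])]
      rw [← Finset.sum_coe_sort GB, ← Finset.sum_neg_distrib]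
      refine Finset.sum_congr rfl fun p _ => by ring
    rw [hAsum, hBsum]
    -- on `T` the two vectors agree
    have hagree : ∀ x ∈ U i, ∑ q ∈ SA, κ q * g q x = ∑ q ∈ SB, κ q * g q x := fun x hx => hshared x ((hU i).1 hx)
    rw [Finset.sum_congr rfl fun x hx => Finset.sum_congr rfl fun y hy =>
      show (∑ q ∈ SA, κ q * g q x) * (∑ q ∈ SA, κ q * g q y) = (∑ q ∈ SB, κ q * g q x) * (∑ q ∈ SB, κ q * g q y) by
        rw [hagree x hx, hagree y (Finset.mem_of_mem_erase hy)]]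
    ring
  have hρ0 : ρ ≠ 0 := by
    rw [Finset.mem_union] at hq₀
    intro h0
    rcases hq₀ with hqA | hqB
    · have hmem : (q₀, q₀) ∈ GA := by rw [hGA, Finset.mem_filter, Finset.mem_product]; exact ⟨⟨hqA, hqA⟩, le_rfl⟩
      have := congrFun h0 (Sum.inl ⟨(q₀, q₀), hmem⟩)
      simp only [ρ, Pi.zero_apply, if_true, one_mul, mul_eq_zero, or_self] at this
      exact hκ0 this
    · have hmem : (q₀, q₀) ∈ GB := by rw [hGB, Finset.mem_filter, Finset.mem_product]; exact ⟨⟨hqB, hqB⟩, le_rfl⟩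
      have := congrFun h0 (Sum.inr (Sum.inl ⟨(q₀, q₀), hmem⟩))
      simp only [ρ, Pi.zero_apply, if_true, one_mul, neg_eq_zero, mul_eq_zero, or_self] at this
      exact hκ0 this
  have hker : 1 ≤ Module.finrank ℂ (LinearMap.ker Φ) := by
    rw [Submodule.one_le_finrank_iff]
    intro hbot
    have : ρ ∈ LinearMap.ker Φ := by rw [LinearMap.mem_ker]; exact hΦρ
    rw [hbot, Submodule.mem_bot] at this
    exact hρ0 this
  have hdimW : Module.finrank ℂ W + 1 ≤ Fintype.card Gen := by
    have hrn := Φ.finrank_range_add_finrank_ker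
    rw [hrange, Module.finrank_fintype_fun_eq_card] at hrn
    omega
  have hcardGen : Fintype.card Gen = GA.card + (GB.card + Oth.card) := by
    simp only [Gen, Fintype.card_sum, Fintype.card_coe]
  -- (d) contradiction with independence of the columns
  by_contra hdet
  have hcols : LinearIndependent ℂ (cfgMat U cols g).col := Matrix.linearIndependent_cols_of_det_ne_zero hdet
  have hcolsW : ∀ k, (cfgMat U cols g).col k ∈ W := fun k => hcol k
  let c : Fin n → W := fun k => ⟨(cfgMat U cols g).col k, hcolsW k⟩
  have hc : LinearIndependent ℂ c := LinearIndependent.of_comp W.subtype hcols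
  have hle := hc.fintype_card_le_finrank
  rw [Fintype.card_fin] at hle
  omega

/-! ## 4. The benchmark instance: `PB(4) ⊔ PB(4) ⊔` one free state on the 21 edges of `K₇` -/

/-- The 21 two-subsets of `Fin 7` (rows). -/
def rowsK7 : Fin 21 → Finset (Fin 7) := ![{0, 1}, {0, 2}, {0, 3}, {0, 4}, {0, 5}, {0, 6}, {1, 2}, {1, 3}, {1, 4}, {1, 5}, {1, 6}, {2, 3}, {2, 4}, {2, 5}, {2, 6}, {3, 4}, {3, 5}, {3, 6}, {4, 5}, {4, 6}, {5, 6}]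

/-- The columns: complete pair blocks on the states `0..3` and `4..7`, and the free state `8`. -/
def colsK7 : Fin 21 → Finset (Fin 9) := ![{0}, {1}, {2}, {3}, {0, 1}, {0, 2}, {0, 3}, {1, 2}, {1, 3}, {2, 3}, {4}, {5}, {6}, {7}, {4, 5}, {4, 6}, {4, 7}, {5, 6}, {5, 7}, {6, 7}, {8}]

/-- **`PB4 ⊔ PB4 ⊔ S1` is singular on `E(K₇)` FOR EVERY TABLE** (`4 + 4 > 7`), although each block alone has full column rank
there and the rows split into per-piece bases for generic tables (kit j332332; memo §11): a cancelling Laplace expansion. -/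
theorem det_cfgMat_K7_eq_zero (g : Fin 9 → Fin 7 → ℂ) : (cfgMat rowsK7 colsK7 g).det = 0 :=
  det_cfgMat_eq_zero_sharedQuadric rowsK7 colsK7 g Finset.univ (fun i => ⟨Finset.subset_univ _, by fin_cases i <;> rfl⟩)
    (Finset.univ.filter fun q : Fin 9 => (q : ℕ) < 4) (Finset.univ.filter fun q : Fin 9 => 4 ≤ (q : ℕ) ∧ (q : ℕ) < 8)
    (by rw [Finset.disjoint_filter]; intro q _ h1 h2; omega) (by decide) (by decide)

end SharedQuadric

end

end Summit.ValiantsHypothesis.ValiantsHypothesis.Theorems.BarrierLever.HiddenStates
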